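import Mathlib.AlgebraicGeometry.EllipticCurve.Affine.Point
import Mathlib.RingTheory.Valuation.ExtendToLocalization
import Mathlib.RingTheory.Valuation.Discrete.Basic
import Mathlib.RingTheory.Norm.Basic
import Literature.NumberTheory.DiophantineGeometry.FunctionFieldDivisors
import Literature.NumberTheory.EllipticCurves.CoordinateRingRegular
import HarnessLib

/-!
# The place at infinity of the function field of a Weierstrass curve

For a field `K` and a Weierstrass curve `W/K` with coordinate ring `R = K[W]` (free over `K[X]` on
`1, y`) and function field `F = K(W) = Frac R`, we construct the *place at infinity* `P_∞` of
`F/K` — the unique place at which `x` has a pole — as an explicit discrete valuation, and compute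
its basic invariants:

* `infValuation W : Valuation K[W] ℤᵐ⁰`, `r ↦ exp (deg N_{K[W]/K[X]}(r))` (`0 ↦ 0`), i.e.
  `|p(x) + q(x)y|_∞ = exp (max (2 deg p) (2 deg q + 3))` (Mathlib
  `CoordinateRing.degree_norm_smul_basis`); so `ord_∞ x = -2`, `ord_∞ y = -3`
  (Silverman, *AEC*, proof of Prop. III.3.1(a): "`x` has a double pole at `O` and no other poles",
  `y` a triple pole);
* `infValuationF W : Valuation K(W) ℤᵐ⁰`, its extension to the fraction field
  (Mathlib `Valuation.extendToLocalization`), with `|x/y|_∞ = exp (-1)` (a uniformizer);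
* `infPlace W : AlgFunctionField.PlaceOver K K(W)`, the valuation ring `O_∞ = {|z|_∞ ≤ 1}`: a
  discrete valuation ring (Mathlib `Valuation.valuationSubring_isDiscreteValuationRing`),
  `≠ K(W)` (`x ∉ O_∞`), containing `K`;
* `degree_infPlace : (infPlace W).degree = 1`: the residue field of `O_∞` is `K` (every
  `z ∈ O_∞` is congruent modulo the maximal ideal to a constant, the quotient of the "leading
  coefficients at infinity", `exists_infValuationF_sub_algebraMap_lt_one`);
* `exists_eq_smul_basis_div`: every element of `K(W)` is `(a(x) + b(x)y)/d(x)` (`[K(W):K(x)] = 2`,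
  Silverman Cor. III.3.1.1), and `exists_eq_algebraMap_of_infValuation_le_exp_one`:
  `K[W] ∩ L(P_∞) = K`.

Everything here holds for an arbitrary Weierstrass equation over a field (no smoothness needed).
This is part of the proof of `AlgFunctionField.genus_functionField_weierstrass`
(`Literature.NumberTheory.DiophantineGeometry.FunctionFieldGenus`): the convention
`|z|_∞ = exp (-ord_∞ z)` is Mathlib's (`IsDedekindDomain.HeightOneSpectrum.valuation`: integers have
valuation `≤ 1`, a uniformizer has valuation `exp (-1)`).

## References

* J. H. Silverman, *The Arithmetic of Elliptic Curves*, 2nd ed., GTM 106, Springer 2009,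
  Prop. III.3.1 and its proof (poles of `x, y` at `O = [0,1,0]`), Cor. III.3.1.1
  (`[K(E):K(x)] = 2`).
* H. Stichtenoth, *Algebraic Function Fields and Codes*, GTM 254, Springer 2009, §6.1 (elliptic
  function fields: the pole `Q_∞` of `x` is totally ramified in `K(x,y)/K(x)`, `deg Q_∞ = 1`) and
  Prop. 1.1.5.
-/

noncomputable section

open Polynomial WithZero
open scoped Polynomial.Bivariate

namespace Literature.NumberTheory.DiophantineGeometry.WeierstrassPlaceAtInfinity

universe u

variable {K : Type u} [Field K] (W : WeierstrassCurve.Affine K)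

/-! ### The degree at infinity on `K[W]` -/

/- `K[W]` is a finite free `K[X]`-module (basis `1, y`): global instances
`Literature.NumberTheory.EllipticCurves.WeierstrassCoordinateRing.instModuleFinite` / `instModuleFree` from `CoordinateRingRegular`. -/

/-- The norm `N_{K[W]/K[X]}(r)` of a nonzero element of the domain `K[W]` is nonzero. [folklore] -/
theorem norm_ne_zero {r : W.CoordinateRing} (hr : r ≠ 0) : Algebra.norm K[X] r ≠ 0 :=
  Algebra.norm_ne_zero_iff.2 hr

/-- Ultrametric inequality for the degree of the norm:
`deg N(r + r') ≤ max (deg N r) (deg N r')`, from the explicit formula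
`deg N(p + qy) = max (2 deg p) (2 deg q + 3)` (Mathlib `CoordinateRing.degree_norm_smul_basis`).
[folklore] -/
theorem degree_norm_add_le (r r' : W.CoordinateRing) :
    (Algebra.norm K[X] (r + r')).degree ≤
      max (Algebra.norm K[X] r).degree (Algebra.norm K[X] r').degree := by
  obtain ⟨p, q, rfl⟩ := WeierstrassCurve.Affine.CoordinateRing.exists_smul_basis_eq r
  obtain ⟨p', q', rfl⟩ := WeierstrassCurve.Affine.CoordinateRing.exists_smul_basis_eq r'
  have hsum : p • (1 : W.CoordinateRing) + q • WeierstrassCurve.Affine.CoordinateRing.mk W Y +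
      (p' • (1 : W.CoordinateRing) + q' • WeierstrassCurve.Affine.CoordinateRing.mk W Y) =
      (p + p') • (1 : W.CoordinateRing) + (q + q') • WeierstrassCurve.Affine.CoordinateRing.mk W Y := by
    simp only [add_smul]; abel
  rw [hsum, WeierstrassCurve.Affine.CoordinateRing.degree_norm_smul_basis,
    WeierstrassCurve.Affine.CoordinateRing.degree_norm_smul_basis,
    WeierstrassCurve.Affine.CoordinateRing.degree_norm_smul_basis]
  refine max_le ?_ ?_
  · rcases le_max_iff.1 (degree_add_le p p') with h | h
    · exact le_max_of_le_left (le_max_of_le_left (nsmul_le_nsmul_right h 2))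
    · exact le_max_of_le_right (le_max_of_le_left (nsmul_le_nsmul_right h 2))
  · rcases le_max_iff.1 (degree_add_le q q') with h | h
    · exact le_max_of_le_left (le_max_of_le_right (by gcongr))
    · exact le_max_of_le_right (le_max_of_le_right (by gcongr))

/-- The *valuation at infinity* on `K[W]`, with values in `ℤᵐ⁰`: `|r|_∞ = exp (deg N(r))` for
`r ≠ 0` (`N` the norm to `K[X]`), `|0|_∞ = 0`; so `|p(x) + q(x)y|_∞ = exp (max (2deg p) (2deg q + 3))`
and `-log |·|_∞ = ord_∞` is the order at the point at infinity `O = [0,1,0]` (Silverman AEC, proof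
of Prop. III.3.1: `ord_O x = -2`, `ord_O y = -3`). Multiplicativity is that of the norm, the
ultrametric inequality is `degree_norm_add_le`. [cite: SilvermanAEC2009, Prop. III.3.1 (proof of (a))] -/
def infValuation : Valuation W.CoordinateRing ℤᵐ⁰ where
  toFun r := if r = 0 then 0 else exp ((Algebra.norm K[X] r).natDegree : ℤ)
  map_zero' := if_pos rfl
  map_one' := by simp
  map_mul' r r' := by
    by_cases hr : r = 0
    · simp [hr]
    by_cases hr' : r' = 0
    · simp [hr']
    rw [if_neg (mul_ne_zero hr hr'), if_neg hr, if_neg hr', map_mul,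
      natDegree_mul (norm_ne_zero W hr) (norm_ne_zero W hr'), Nat.cast_add, exp_add]
  map_add_le_max' r r' := by
    by_cases hs : r + r' = 0
    · simp [hs]
    by_cases hr : r = 0
    · simp [hr]
    by_cases hr' : r' = 0
    · simp [hr']
    simp only [if_neg hs, if_neg hr, if_neg hr', le_max_iff, exp_le_exp, Nat.cast_le]
    have h := degree_norm_add_le W r r'
    rw [degree_eq_natDegree (norm_ne_zero W hs), degree_eq_natDegree (norm_ne_zero W hr),
      degree_eq_natDegree (norm_ne_zero W hr'), le_max_iff, Nat.cast_le, Nat.cast_le] at h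
    exact h

/-- Unfolding of `infValuation` at a nonzero element. [folklore] -/
theorem infValuation_apply {r : W.CoordinateRing} (hr : r ≠ 0) :
    infValuation W r = exp ((Algebra.norm K[X] r).natDegree : ℤ) :=
  if_neg hr

/-- Nonzero elements of `K[W]` have `1 ≤ |r|_∞` (they are regular away from infinity).
[folklore] -/
theorem one_le_infValuation {r : W.CoordinateRing} (hr : r ≠ 0) : 1 ≤ infValuation W r := by
  rw [infValuation_apply W hr, ← exp_zero, exp_le_exp]
  exact Nat.cast_nonneg _

/-- The support of `|·|_∞` is `0`: nonzero elements have nonzero valuation. [folklore] -/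
theorem infValuation_ne_zero {r : W.CoordinateRing} (hr : r ≠ 0) : infValuation W r ≠ 0 := by
  rw [infValuation_apply W hr]; exact exp_ne_zero

/-- `|r|_∞ ≤ exp n ↔ deg N(r) ≤ n` (also for `r = 0`, where `deg 0 = ⊥`). [folklore] -/
theorem infValuation_le_exp_iff (r : W.CoordinateRing) (n : ℕ) :
    infValuation W r ≤ exp (n : ℤ) ↔ (Algebra.norm K[X] r).degree ≤ n := by
  by_cases hr : r = 0
  · simp [hr]
  rw [infValuation_apply W hr, exp_le_exp, Nat.cast_le, natDegree_le_iff_degree_le]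

/-- `|r|_∞ < exp n ↔ deg N(r) < n` (also for `r = 0`). [folklore] -/
theorem infValuation_lt_exp_iff (r : W.CoordinateRing) (n : ℕ) :
    infValuation W r < exp (n : ℤ) ↔ (Algebra.norm K[X] r).degree < n := by
  by_cases hr : r = 0
  · simp [hr]
  rw [infValuation_apply W hr, exp_lt_exp, Nat.cast_lt, degree_eq_natDegree (norm_ne_zero W hr),
    Nat.cast_lt]

/-- `2 deg f ≤ n ↔ f = 0 ∨ 2 deg f ≤ n` with the right-hand degree in `ℕ` (bookkeeping between
`Polynomial.degree : WithBot ℕ` and `natDegree`). [folklore] -/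
theorem two_nsmul_degree_le_iff (f : K[X]) (n : ℕ) :
    2 • f.degree ≤ (n : WithBot ℕ) ↔ f = 0 ∨ 2 * f.natDegree ≤ n := by
  by_cases hf : f = 0
  · simp [hf]
  · rw [degree_eq_natDegree hf, two_nsmul, ← Nat.cast_add, Nat.cast_le]
    simp only [hf, false_or]
    omega

/-- `2 deg f < n ↔ f = 0 ∨ 2 deg f < n` (degrees in `ℕ` on the right). [folklore] -/
theorem two_nsmul_degree_lt_iff (f : K[X]) (n : ℕ) :
    2 • f.degree < (n : WithBot ℕ) ↔ f = 0 ∨ 2 * f.natDegree < n := by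
  by_cases hf : f = 0
  · simp [hf]
  · rw [degree_eq_natDegree hf, two_nsmul, ← Nat.cast_add, Nat.cast_lt]
    simp only [hf, false_or]
    omega

/-- `2 deg f + 3 ≤ n ↔ f = 0 ∨ 2 deg f + 3 ≤ n` (degrees in `ℕ` on the right). [folklore] -/
theorem two_nsmul_degree_add_three_le_iff (f : K[X]) (n : ℕ) :
    2 • f.degree + 3 ≤ (n : WithBot ℕ) ↔ f = 0 ∨ 2 * f.natDegree + 3 ≤ n := by
  by_cases hf : f = 0
  · simp [hf]
  · rw [degree_eq_natDegree hf, two_nsmul, ← Nat.cast_add, ← Nat.cast_ofNat, ← Nat.cast_add,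
      Nat.cast_le]
    simp only [hf, false_or]
    omega

/-- `2 deg f + 3 < n ↔ f = 0 ∨ 2 deg f + 3 < n` (degrees in `ℕ` on the right). [folklore] -/
theorem two_nsmul_degree_add_three_lt_iff (f : K[X]) (n : ℕ) :
    2 • f.degree + 3 < (n : WithBot ℕ) ↔ f = 0 ∨ 2 * f.natDegree + 3 < n := by
  by_cases hf : f = 0
  · simp [hf]
  · rw [degree_eq_natDegree hf, two_nsmul, ← Nat.cast_add, ← Nat.cast_ofNat, ← Nat.cast_add,
      Nat.cast_lt]
    simp only [hf, false_or]
    omega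

/-- `|p(x) + q(x)y|_∞ ≤ exp n ↔ 2 deg p ≤ n ∧ 2 deg q + 3 ≤ n` (degrees in `WithBot ℕ`, so the
conditions are stated with `natDegree` and are vacuous for `p = 0` resp. `q = 0`). This describes the Riemann–Roch spaces
`L(n·P_∞) ∩ K[W]` (Silverman AEC, proof of Prop. III.3.1: `L(n(O))` has basis
`{xⁱ} ∪ {xʲy}`, `2i ≤ n`, `2j + 3 ≤ n`). [cite: SilvermanAEC2009, Prop. III.3.1 (proof of (a))] -/
theorem infValuation_smul_basis_le_exp_iff (p q : K[X]) (n : ℕ) :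
    infValuation W (p • (1 : W.CoordinateRing) + q • WeierstrassCurve.Affine.CoordinateRing.mk W Y)
        ≤ exp (n : ℤ) ↔ (p = 0 ∨ 2 * p.natDegree ≤ n) ∧ (q = 0 ∨ 2 * q.natDegree + 3 ≤ n) := by
  rw [infValuation_le_exp_iff, WeierstrassCurve.Affine.CoordinateRing.degree_norm_smul_basis,
    max_le_iff, two_nsmul_degree_le_iff, two_nsmul_degree_add_three_le_iff]

/-- Strict version: `|p(x) + q(x)y|_∞ < exp n ↔ 2 deg p < n ∧ 2 deg q + 3 < n`. [folklore] -/
theorem infValuation_smul_basis_lt_exp_iff (p q : K[X]) (n : ℕ) :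
    infValuation W (p • (1 : W.CoordinateRing) + q • WeierstrassCurve.Affine.CoordinateRing.mk W Y)
        < exp (n : ℤ) ↔ (p = 0 ∨ 2 * p.natDegree < n) ∧ (q = 0 ∨ 2 * q.natDegree + 3 < n) := by
  rw [infValuation_lt_exp_iff, WeierstrassCurve.Affine.CoordinateRing.degree_norm_smul_basis,
    max_lt_iff, two_nsmul_degree_lt_iff, two_nsmul_degree_add_three_lt_iff]

/-- `|h(x)|_∞ = exp (2 deg h)` for `0 ≠ h ∈ K[X]` (`N(h) = h²`). [folklore] -/
theorem infValuation_algebraMap {h : K[X]} (hh : h ≠ 0) :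
    infValuation W (algebraMap K[X] W.CoordinateRing h) = exp ((2 * h.natDegree : ℕ) : ℤ) := by
  have hne : algebraMap K[X] W.CoordinateRing h ≠ 0 := by
    intro h0
    have : h • (1 : W.CoordinateRing) + (0 : K[X]) • WeierstrassCurve.Affine.CoordinateRing.mk W Y
        = 0 := by
      rw [zero_smul, add_zero, Algebra.smul_def, mul_one, h0]
    exact hh (WeierstrassCurve.Affine.CoordinateRing.smul_basis_eq_zero this).1
  rw [infValuation_apply W hne, Algebra.norm_algebraMap, natDegree_pow,
    Module.finrank_eq_card_basis (WeierstrassCurve.Affine.CoordinateRing.basis W), Fintype.card_fin]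

/-- Nonzero constants have `|c|_∞ = 1`. [folklore] -/
theorem infValuation_C {c : K} (hc : c ≠ 0) :
    infValuation W (algebraMap K[X] W.CoordinateRing (C c)) = 1 := by
  rw [infValuation_algebraMap W (C_ne_zero.2 hc), natDegree_C]
  simp

/-- `|x|_∞ = exp 2`: `x` has a double pole at infinity (Silverman AEC, proof of Prop. III.3.1).
[cite: SilvermanAEC2009, Prop. III.3.1 (proof of (a))] -/
theorem infValuation_x :
    infValuation W (algebraMap K[X] W.CoordinateRing X) = exp 2 := by
  rw [infValuation_algebraMap W X_ne_zero, natDegree_X]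
  simp

/-- `|y|_∞ = exp 3`: `y` has a triple pole at infinity (Silverman AEC, proof of Prop. III.3.1).
[cite: SilvermanAEC2009, Prop. III.3.1 (proof of (a))] -/
theorem infValuation_y :
    infValuation W (WeierstrassCurve.Affine.CoordinateRing.mk W Y) = exp 3 := by
  have hne : WeierstrassCurve.Affine.CoordinateRing.mk W Y ≠ 0 := by
    intro h0
    have h : (0 : K[X]) • (1 : W.CoordinateRing) +
        (1 : K[X]) • WeierstrassCurve.Affine.CoordinateRing.mk W Y = 0 := by
      rw [zero_smul, one_smul, zero_add, h0]
    exact one_ne_zero (WeierstrassCurve.Affine.CoordinateRing.smul_basis_eq_zero h).2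
  have hdeg : (Algebra.norm K[X] (WeierstrassCurve.Affine.CoordinateRing.mk W Y)).degree = 3 := by
    have h := WeierstrassCurve.Affine.CoordinateRing.degree_norm_smul_basis (W' := W) 0 1
    rw [zero_smul, one_smul, zero_add, degree_zero, degree_one] at h
    rw [h]
    exact max_eq_right bot_le
  rw [infValuation_apply W hne, natDegree_eq_of_degree_eq_some hdeg]
  simp


/-! ### The valuation at infinity on `K(W)` and the place `P_∞` -/

/-- Nonzero divisors of `K[W]` lie outside the support of `|·|_∞`. [folklore] -/
theorem nonZeroDivisors_le_supp_primeCompl :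
    nonZeroDivisors W.CoordinateRing ≤ (infValuation W).supp.primeCompl := fun _ hs ↦
  infValuation_ne_zero W (nonZeroDivisors.ne_zero hs)

/-- The valuation at infinity `|·|_∞ : K(W) → ℤᵐ⁰` on the function field, the extension of
`infValuation` to the fraction field (Mathlib `Valuation.extendToLocalization`). [folklore] -/
def infValuationF : Valuation W.FunctionField ℤᵐ⁰ :=
  (infValuation W).extendToLocalization (nonZeroDivisors_le_supp_primeCompl W) W.FunctionField

/-- `|r|_∞` of an element of `K[W]` computed in `K(W)`. [folklore] -/
@[simp]
theorem infValuationF_algebraMap (r : W.CoordinateRing) :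
    infValuationF W (algebraMap W.CoordinateRing W.FunctionField r) = infValuation W r :=
  Valuation.extendToLocalization_apply_map_apply _ _ _ r

/-- `|h(x)|_∞` of a polynomial in `x` computed in `K(W)`: `exp (2 deg h)` for `h ≠ 0`. [folklore] -/
theorem infValuationF_algebraMap_polynomial {h : K[X]} (hh : h ≠ 0) :
    infValuationF W (algebraMap K[X] W.FunctionField h) = exp ((2 * h.natDegree : ℕ) : ℤ) := by
  rw [IsScalarTower.algebraMap_apply K[X] W.CoordinateRing W.FunctionField, infValuationF_algebraMap,
    infValuation_algebraMap W hh]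

/-- Constants of `K` have `|c|_∞ ≤ 1` (indeed `= 1` for `c ≠ 0`). [folklore] -/
theorem infValuationF_algebraMap_le_one (c : K) :
    infValuationF W (algebraMap K W.FunctionField c) ≤ 1 := by
  rw [IsScalarTower.algebraMap_apply K K[X] W.FunctionField,
    IsScalarTower.algebraMap_apply K[X] W.CoordinateRing W.FunctionField, infValuationF_algebraMap,
    Polynomial.algebraMap_eq]
  by_cases hc : c = 0
  · simp [hc]
  · exact (infValuation_C W hc).le

/-- `|x|_∞ = exp 2` in `K(W)`. [cite: SilvermanAEC2009, Prop. III.3.1 (proof of (a))] -/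
theorem infValuationF_x :
    infValuationF W (algebraMap K[X] W.FunctionField X) = exp 2 := by
  rw [IsScalarTower.algebraMap_apply K[X] W.CoordinateRing W.FunctionField, infValuationF_algebraMap,
    infValuation_x]

/-- `|y|_∞ = exp 3` in `K(W)`. [cite: SilvermanAEC2009, Prop. III.3.1 (proof of (a))] -/
theorem infValuationF_y :
    infValuationF W (algebraMap W.CoordinateRing W.FunctionField
      (WeierstrassCurve.Affine.CoordinateRing.mk W Y)) = exp 3 := by
  rw [infValuationF_algebraMap, infValuation_y]

/-- `|x/y|_∞ = exp (-1)`: `x/y` is a uniformizer at infinity (Silverman AEC §IV.1: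
`z = -x/y` is a local uniformizer at `O`; here only the value is recorded). [cite: SilvermanAEC2009, §IV.1] -/
theorem infValuationF_x_div_y :
    infValuationF W (algebraMap K[X] W.FunctionField X /
      algebraMap W.CoordinateRing W.FunctionField (WeierstrassCurve.Affine.CoordinateRing.mk W Y)) =
      exp (-1) := by
  rw [map_div₀, infValuationF_x, infValuationF_y, ← exp_sub]; rfl

/-- `exp (-1)` is a value of `|·|_∞` (so the value group is all of `ℤ`, and irreducibles of
`O_∞` have valuation `exp (-1)`). [folklore] -/
theorem exists_infValuationF_eq_exp_neg_one : ∃ z : W.FunctionField, infValuationF W z = exp (-1) :=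
  ⟨_, infValuationF_x_div_y W⟩

/-- `|·|_∞` is a nontrivial valuation on `K(W)` (`|x|_∞ = exp 2`); hence (Mathlib) its valuation
ring is a discrete valuation ring. [folklore] -/
instance infValuationF_isNontrivial : (infValuationF W).IsNontrivial :=
  ⟨algebraMap K[X] W.FunctionField X, by rw [infValuationF_x]; exact exp_ne_zero,
    by rw [infValuationF_x, ← exp_zero, Ne, exp_inj]; decide⟩

/-- **The place at infinity** `P_∞` of `K(W)/K`: the valuation ring `O_∞ = {z : |z|_∞ ≤ 1}` of
`|·|_∞`, a discrete valuation ring of `K(W)` (Mathlib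
`Valuation.valuationSubring_isDiscreteValuationRing`) containing `K` and not containing `x` — the
unique place of `K(W)` above the pole of `x` in `K(x)` (Silverman AEC Prop. III.3.1: the point
`O = [0,1,0]`; Stichtenoth §6.1: the place `Q_∞` of an elliptic function field). [cite: SilvermanAEC2009, Prop. III.3.1] -/
def infPlace : AlgFunctionField.PlaceOver K W.FunctionField where
  toValuationSubring := (infValuationF W).valuationSubring
  ne_top h := by
    have hx : algebraMap K[X] W.FunctionField X ∈ (infValuationF W).valuationSubring :=
      h ▸ Subring.mem_top _
    rw [Valuation.mem_valuationSubring_iff, infValuationF_x, ← exp_zero, exp_le_exp] at hx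
    exact absurd hx (by decide)
  isDVR := inferInstance
  algebraMap_mem c := infValuationF_algebraMap_le_one W c

/-- The valuation ring of `P_∞` is `{z : |z|_∞ ≤ 1}` (definitional). [folklore] -/
theorem infPlace_toValuationSubring :
    (infPlace W).toValuationSubring = (infValuationF W).valuationSubring :=
  rfl

/-- Membership in `O_∞` (definitional). [folklore] -/
theorem mem_infPlace_iff (z : W.FunctionField) :
    z ∈ (infPlace W).toValuationSubring ↔ infValuationF W z ≤ 1 :=
  Iff.rfl

/-- `x ∉ O_∞` (`x` has a pole at infinity). [cite: SilvermanAEC2009, Prop. III.3.1 (proof of (a))] -/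
theorem x_not_mem_infPlace :
    algebraMap K[X] W.FunctionField X ∉ (infPlace W).toValuationSubring := by
  rw [mem_infPlace_iff, infValuationF_x, ← exp_zero, exp_le_exp]; decide

/-- `K[W] ∩ L(P_∞) = K`: an element of `K[W]` with at most a simple pole at infinity is a constant,
since `|p(x) + q(x)y|_∞ ≤ exp 1` forces `q = 0` and `deg p ≤ 0` (there is no function with a single
simple pole: `deg N(r) ≠ 1`, Mathlib `CoordinateRing.degree_norm_ne_one`). This is `L((O)) = K` for
`K(W)`, cf. Silverman AEC, proof of Prop. III.3.1 (`ℓ(n(O)) = n`, bases of `L(n(O))` for small `n`).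
[cite: SilvermanAEC2009, Prop. III.3.1 (proof of (a))] -/
theorem exists_eq_algebraMap_of_infValuation_le_exp_one {r : W.CoordinateRing}
    (hr : infValuation W r ≤ exp 1) : ∃ c : K, r = algebraMap K W.CoordinateRing c := by
  obtain ⟨p, q, rfl⟩ := WeierstrassCurve.Affine.CoordinateRing.exists_smul_basis_eq r
  rw [show (1 : ℤ) = ((1 : ℕ) : ℤ) from rfl, infValuation_smul_basis_le_exp_iff] at hr
  obtain ⟨hp, hq⟩ := hr
  have hq0 : q = 0 := hq.resolve_right (by omega)
  have hp0 : p.degree ≤ 0 := by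
    rcases hp with rfl | hp
    · simp
    · exact (degree_le_natDegree).trans (by exact_mod_cast (by omega : p.natDegree ≤ 0))
  refine ⟨p.coeff 0, ?_⟩
  rw [hq0, zero_smul, add_zero, IsScalarTower.algebraMap_apply K K[X] W.CoordinateRing,
    Polynomial.algebraMap_eq, Algebra.smul_def, mul_one, ← eq_C_of_degree_le_zero hp0]

/-- `K[W] ∩ O_∞ = K`: an element of `K[W]` lying in `O_∞` (no pole at infinity) is a constant. This
is `L(0) = K` for `K(W)` (Silverman AEC, proof of Prop. III.3.1). [cite: SilvermanAEC2009, Prop. III.3.1 (proof of (a))] -/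
theorem exists_eq_algebraMap_of_infValuation_le_one {r : W.CoordinateRing}
    (hr : infValuation W r ≤ 1) : ∃ c : K, r = algebraMap K W.CoordinateRing c :=
  exists_eq_algebraMap_of_infValuation_le_exp_one W (hr.trans (by rw [← exp_zero, exp_le_exp]; decide))

/-! ### The residue field of `P_∞` is `K` -/

/-- Rationalising denominators: every element of `K(W)` is `(a(x) + b(x)y)/d(x)` with `d ≠ 0` a
polynomial in `x` alone (multiply numerator and denominator `s` by the conjugate of `s`, whose
product with `s` is the norm `N(s) ∈ K[X]`; Mathlib `CoordinateRing.coe_norm_smul_basis`).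
Equivalently `K(W) = K(x) ⊕ K(x)y` (Silverman AEC Cor. III.3.1.1: `[K(E):K(x)] = 2`). [cite: SilvermanAEC2009, Cor. III.3.1.1] -/
theorem exists_eq_smul_basis_div (z : W.FunctionField) :
    ∃ a b d : K[X], d ≠ 0 ∧ z = algebraMap W.CoordinateRing W.FunctionField
      (a • (1 : W.CoordinateRing) + b • WeierstrassCurve.Affine.CoordinateRing.mk W Y) /
        algebraMap K[X] W.FunctionField d := by
  obtain ⟨r, s, hs, rfl⟩ := IsFractionRing.div_surjective (A := W.CoordinateRing) z
  have hs0 : s ≠ 0 := nonZeroDivisors.ne_zero hs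
  obtain ⟨p, q, rfl⟩ := WeierstrassCurve.Affine.CoordinateRing.exists_smul_basis_eq s
  -- the conjugate `s' = mk (C p + C q * (-Y - C (a₁X + a₃)))` with `s * s' = N(s)`
  set s' : W.CoordinateRing := WeierstrassCurve.Affine.CoordinateRing.mk W
    (C p + C q * (-(Y : K[X][Y]) - C (C W.a₁ * X + C W.a₃))) with hs'
  have hnorm : algebraMap K[X] W.CoordinateRing
      (Algebra.norm K[X] (p • (1 : W.CoordinateRing) + q • WeierstrassCurve.Affine.CoordinateRing.mk W Y))
      = (p • (1 : W.CoordinateRing) + q • WeierstrassCurve.Affine.CoordinateRing.mk W Y) * s' := by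
    have h := WeierstrassCurve.Affine.CoordinateRing.coe_norm_smul_basis (W' := W) p q
    rw [map_mul] at h
    have hpq : WeierstrassCurve.Affine.CoordinateRing.mk W (C p + C q * Y) =
        p • (1 : W.CoordinateRing) + q • WeierstrassCurve.Affine.CoordinateRing.mk W Y := by
      rw [map_add, map_mul, WeierstrassCurve.Affine.CoordinateRing.smul,
        WeierstrassCurve.Affine.CoordinateRing.smul, mul_one]
    rw [hpq] at h
    rw [AdjoinRoot.algebraMap_eq]
    exact h
  set d := Algebra.norm K[X] (p • (1 : W.CoordinateRing) + q • WeierstrassCurve.Affine.CoordinateRing.mk W Y)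
  have hd : d ≠ 0 := norm_ne_zero W hs0
  obtain ⟨a, b, hab⟩ := WeierstrassCurve.Affine.CoordinateRing.exists_smul_basis_eq (r * s')
  refine ⟨a, b, d, hd, ?_⟩
  rw [hab, IsScalarTower.algebraMap_apply K[X] W.CoordinateRing W.FunctionField, hnorm, map_mul,
    map_mul]
  have hsF : algebraMap W.CoordinateRing W.FunctionField
      (p • (1 : W.CoordinateRing) + q • WeierstrassCurve.Affine.CoordinateRing.mk W Y) ≠ 0 :=
    IsFractionRing.to_map_ne_zero_of_mem_nonZeroDivisors hs
  have hs'F : algebraMap W.CoordinateRing W.FunctionField s' ≠ 0 := by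
    intro h0
    apply hd
    have := congrArg (algebraMap W.CoordinateRing W.FunctionField) hnorm
    rw [map_mul, h0, mul_zero, ← IsScalarTower.algebraMap_apply,
      map_eq_zero_iff _ (FaithfulSMul.algebraMap_injective K[X] W.FunctionField)] at this
    exact this
  field_simp

/-- **Leading coefficient at infinity.** Every `z ∈ O_∞` is congruent to a constant modulo the
maximal ideal of `O_∞`: writing `z = (a(x) + b(x)y)/d(x)` (`exists_eq_smul_basis_div`), `|z|_∞ ≤ 1`
means `deg a ≤ deg d` and `2 deg b + 3 ≤ 2 deg d`, and with `c = a_{deg d}/\operatorname{lc}(d)`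
one gets `|z - c|_∞ = |((a - c d) + b y)/d|_∞ < 1`. Hence the residue field of `P_∞` is `K`
(`deg P_∞ = 1`; Silverman AEC Prop. III.3.1: `O` is a `K`-rational point; Stichtenoth §6.1).
[cite: SilvermanAEC2009, Prop. III.3.1] -/
theorem exists_infValuationF_sub_algebraMap_lt_one {z : W.FunctionField} (hz : infValuationF W z ≤ 1) :
    ∃ c : K, infValuationF W (z - algebraMap K W.FunctionField c) < 1 := by
  obtain ⟨a, b, d, hd, rfl⟩ := exists_eq_smul_basis_div W z
  have hdF : algebraMap K[X] W.FunctionField d ≠ 0 :=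
    (map_ne_zero_iff _ (FaithfulSMul.algebraMap_injective K[X] W.FunctionField)).2 hd
  have hvd : infValuationF W (algebraMap K[X] W.FunctionField d) = exp ((2 * d.natDegree : ℕ) : ℤ) :=
    infValuationF_algebraMap_polynomial W hd
  have hvd0 : infValuationF W (algebraMap K[X] W.FunctionField d) ≠ 0 := by
    rw [hvd]; exact exp_ne_zero
  rw [map_div₀, div_le_one₀ (zero_lt_iff.2 hvd0), hvd, infValuationF_algebraMap,
    infValuation_smul_basis_le_exp_iff] at hz
  obtain ⟨ha, hb⟩ := hz
  set c : K := a.coeff d.natDegree / d.leadingCoeff with hc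
  refine ⟨c, ?_⟩
  -- `z - c = ((a - C c * d) + b y)/d`
  have hsub : algebraMap W.CoordinateRing W.FunctionField
        (a • (1 : W.CoordinateRing) + b • WeierstrassCurve.Affine.CoordinateRing.mk W Y) /
        algebraMap K[X] W.FunctionField d - algebraMap K W.FunctionField c =
      algebraMap W.CoordinateRing W.FunctionField
        ((a - C c * d) • (1 : W.CoordinateRing) + b • WeierstrassCurve.Affine.CoordinateRing.mk W Y) /
        algebraMap K[X] W.FunctionField d := by
    rw [eq_div_iff hdF, sub_mul, div_mul_cancel₀ _ hdF,
      IsScalarTower.algebraMap_apply K K[X] W.FunctionField, Polynomial.algebraMap_eq,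
      IsScalarTower.algebraMap_apply K[X] W.CoordinateRing W.FunctionField (C c),
      IsScalarTower.algebraMap_apply K[X] W.CoordinateRing W.FunctionField d,
      ← map_mul, ← map_mul, ← map_sub]
    congr 1
    simp only [Algebra.smul_def, map_sub, map_mul]
    ring
  rw [hsub, map_div₀, div_lt_one₀ (zero_lt_iff.2 hvd0), hvd, infValuationF_algebraMap,
    infValuation_smul_basis_lt_exp_iff]
  refine ⟨?_, hb.imp_right (by omega)⟩
  -- `deg (a - C c * d) < deg d`
  have hlt : (a - C c * d).degree < d.natDegree := by
    refine (degree_lt_iff_coeff_zero _ _).2 fun m hm ↦ ?_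
    rw [coeff_sub, coeff_C_mul]
    rcases hm.eq_or_lt with h | h
    · rw [← h, hc, ← Polynomial.leadingCoeff, div_mul_cancel₀ _ (leadingCoeff_ne_zero.2 hd),
        sub_self]
    · have had : a.coeff m = 0 := by
        rcases ha with rfl | ha
        · simp
        · exact coeff_eq_zero_of_natDegree_lt (by omega)
      rw [had, coeff_eq_zero_of_natDegree_lt h, mul_zero, sub_self]
  by_cases h0 : a - C c * d = 0
  · exact Or.inl h0
  · refine Or.inr ?_
    rw [degree_eq_natDegree h0, Nat.cast_lt] at hlt
    omega

/-- The structure map `K → O_∞/m_∞` to the residue field of `P_∞` is surjective. [cite: SilvermanAEC2009, Prop. III.3.1] -/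
theorem algebraMap_residueField_surjective :
    Function.Surjective (algebraMap K (infPlace W).residueField) := by
  intro ξ
  obtain ⟨z, rfl⟩ := IsLocalRing.residue_surjective ξ
  obtain ⟨c, hc⟩ := exists_infValuationF_sub_algebraMap_lt_one W z.2
  refine ⟨c, ?_⟩
  rw [AlgFunctionField.PlaceOver.algebraMap_residueField_apply, eq_comm, ← sub_eq_zero, ← map_sub,
    IsLocalRing.residue_eq_zero_iff, ValuationSubring.valuation_lt_one_iff]
  exact ((infValuationF W).isEquiv_valuation_valuationSubring.lt_one_iff_lt_one).1 hc

/-- **The place at infinity is rational**: `deg P_∞ = [O_∞/m_∞ : K] = 1` (Silverman AEC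
Prop. III.3.1: `O = [0,1,0] ∈ E(K)`; Stichtenoth §6.1: `deg Q_∞ = 1`). [cite: SilvermanAEC2009, Prop. III.3.1] -/
theorem degree_infPlace : (infPlace W).degree = 1 := by
  have hinj : Function.Injective (algebraMap K (infPlace W).residueField) :=
    (algebraMap K (infPlace W).residueField).injective
  have e : K ≃ₗ[K] (infPlace W).residueField :=
    LinearEquiv.ofBijective (Algebra.linearMap K (infPlace W).residueField)
      ⟨hinj, algebraMap_residueField_surjective W⟩
  rw [AlgFunctionField.PlaceOver.degree, ← e.finrank_eq, Module.finrank_self]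

/-- `P_∞` is a rational place of `K(W)/K`. [cite: SilvermanAEC2009, Prop. III.3.1] -/
theorem isRational_infPlace : (infPlace W).IsRational :=
  degree_infPlace W

end Literature.NumberTheory.DiophantineGeometry.WeierstrassPlaceAtInfinity
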